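import Literature.Analysis.FluidPDE.LerayProfileCalculus
import Literature.Analysis.FluidPDE.VectorCalculusProofs
import HarnessLib

/-!
# StrainDoorsPoissonTrace — door family S37 «StrainDoors» (nsreg-p1 ROUND-35), plate «PoissonTrace», trace form

S-door lane (ns-sfl-p1 g5; LEAD ns-s30-p1 g3; plan of record nsreg-p1 g31 2026-08-28T17:58:24Z; texts pending —
this file is the TEXT-INDEPENDENT core; `--supports stmt-NavierStokesRegularity-0056 --as helper`).

The pressure Poisson equation of a classical unforced solution on the frame slab `[0,T) × E`, in TRACE FORM at
every interior time: `Δp(t,x) = −tr(∇u(t,x) ∘ ∇u(t,x))` (take the divergence of the momentum equation: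
`div ∂ₜu = 0`, `div Δu = 0`, `div((u·∇)u) = tr((∇u)²)` for `div u = 0`). In `ℝ³`, `−tr(A²) = ½|ω|² − |S|²_F`
(`S = ½(A + Aᵀ)`, `ω = curl`), the split form of the plate; the trace form is what the tree's vocabulary gives by
name (`laplacian_pressure_eq_of_isClassicalNSSolutionOn`, `divergence_convect_self_eq`).

WHAT THIS IS NOT: an identity serving a regularity CRITERION (door family S37); item 0056 `NoTypeII` and NS regularity
are NOT proved; nothing here is a route or a summit statement.
-/

-- the summit's problem namespace repeats the summit name (tree layout)
set_option linter.dupNamespace false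

noncomputable section

open Set Function Filter InnerProductSpace
open scoped Laplacian ContDiff RealInnerProductSpace
open Literature.Analysis Literature.Analysis.FluidPDE VectorCalculus

namespace Summit.NavierStokesRegularity.NavierStokesRegularity.Theorems.ArgmaxDoors

variable {E : Type*} [NormedAddCommGroup E] [InnerProductSpace ℝ E] [FiniteDimensional ℝ E]

/-- **Pressure Poisson equation, trace form** (plate «PoissonTrace» core): for a classical unforced Navier–Stokes
solution on the slab `[0,T)`, at every interior time `t ∈ (0,T)` and every `x`,
`Δp(t,x) = −tr(∇u(t,x) ∘ ∇u(t,x))`. -/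
theorem laplacian_pressure_eq_neg_traceCLM {ν T : ℝ} {u : ℝ → E → E} {p : ℝ → E → ℝ}
    (hsol : IsClassicalNSSolutionOn (Ico 0 T) ν 0 u p) {t : ℝ} (ht : t ∈ Ioo 0 T) (x : E) :
    Δ (p t) x = -traceCLM ((fderiv ℝ (u t) x).comp (fderiv ℝ (u t) x)) := by
  have hti : t ∈ interior (Ico (0 : ℝ) T) := by
    rw [interior_Ico]; exact ht
  have htc : t ∈ Ico (0 : ℝ) T := Ioo_subset_Ico_self ht
  have h1 := laplacian_pressure_eq_of_isClassicalNSSolutionOn hsol hti x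
  have hu2 : ContDiff ℝ 2 (u t) := (hsol.contDiff_velocity htc).of_le (by norm_cast)
  have h2 := divergence_convect_self_eq hu2 (hsol.divFree t htc) x
  rw [h1, h2]
  have h0 : VectorCalculus.divergence ((0 : ℝ → E → E) t) x = 0 := by
    simp [VectorCalculus.divergence]
  rw [h0, add_zero]

/-! ### The split form in `ℝ³`: `−tr(A²) = ½|ω|² − |S|²_F` -/

/-- Coordinates of the adjoint in the standard frame of `ℝ³`: `(L† eᵢ)ₖ = (L eₖ)ᵢ`. -/
theorem adjoint_single_apply (L : EuclideanSpace ℝ (Fin 3) →L[ℝ] EuclideanSpace ℝ (Fin 3)) (i k : Fin 3) :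
    (ContinuousLinearMap.adjoint L (EuclideanSpace.single i 1)) k = L (EuclideanSpace.single k 1) i := by
  have h1 := EuclideanSpace.inner_single_left k (1 : ℝ)
    (ContinuousLinearMap.adjoint L (EuclideanSpace.single i 1))
  rw [ContinuousLinearMap.adjoint_inner_right, EuclideanSpace.inner_single_right] at h1
  simpa using h1.symm

/-- `tr(L ∘ L) = Σᵢ Σₖ Lₖᵢ Lᵢₖ` in the standard frame of `ℝ³` (`Lᵢₖ = (L eᵢ)ₖ`). -/
theorem traceCLM_comp_self_eq_sum (L : EuclideanSpace ℝ (Fin 3) →L[ℝ] EuclideanSpace ℝ (Fin 3)) :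
    traceCLM (L.comp L) =
      ∑ i, ∑ k, L (EuclideanSpace.single k 1) i * L (EuclideanSpace.single i 1) k := by
  rw [traceCLM_apply, LinearMap.trace_eq_sum_inner _ (EuclideanSpace.basisFun (Fin 3) ℝ)]
  refine Finset.sum_congr rfl fun i _ => ?_
  rw [EuclideanSpace.basisFun_apply, ContinuousLinearMap.coe_coe, ContinuousLinearMap.comp_apply,
    ← ContinuousLinearMap.adjoint_inner_left, PiLp.inner_apply]
  refine Finset.sum_congr rfl fun k _ => ?_
  rw [adjoint_single_apply]
  simp [mul_comm]

/-- `|L + L†|²_F = Σᵢ Σₖ (Lᵢₖ + Lₖᵢ)²` in the standard frame of `ℝ³`. -/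
theorem frobeniusNormSq_add_adjoint_eq_sum (L : EuclideanSpace ℝ (Fin 3) →L[ℝ] EuclideanSpace ℝ (Fin 3)) :
    frobeniusNormSq (L + ContinuousLinearMap.adjoint L) =
      ∑ i, ∑ k, (L (EuclideanSpace.single i 1) k + L (EuclideanSpace.single k 1) i) ^ 2 := by
  rw [frobeniusNormSq_eq_sum (EuclideanSpace.basisFun (Fin 3) ℝ)]
  refine Finset.sum_congr rfl fun i _ => ?_
  rw [EuclideanSpace.norm_sq_eq]
  refine Finset.sum_congr rfl fun k _ => ?_
  rw [Real.norm_eq_abs, sq_abs, EuclideanSpace.basisFun_apply, add_apply,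
    PiLp.add_apply, adjoint_single_apply]

/-- `‖curl v(x)‖²` in the standard frame (`Lᵢₖ = (Dv(x) eᵢ)ₖ`). -/
theorem norm_curl_sq_eq_coord (v : EuclideanSpace ℝ (Fin 3) → EuclideanSpace ℝ (Fin 3)) (x : EuclideanSpace ℝ (Fin 3)) :
    ‖curl v x‖ ^ 2 =
      (fderiv ℝ v x (EuclideanSpace.single 1 1) 2 - fderiv ℝ v x (EuclideanSpace.single 2 1) 1) ^ 2 +
      (fderiv ℝ v x (EuclideanSpace.single 2 1) 0 - fderiv ℝ v x (EuclideanSpace.single 0 1) 2) ^ 2 +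
      (fderiv ℝ v x (EuclideanSpace.single 0 1) 1 - fderiv ℝ v x (EuclideanSpace.single 1 1) 0) ^ 2 := by
  rw [curl, EuclideanSpace.norm_sq_eq, Fin.sum_univ_three]
  simp [Real.norm_eq_abs, sq_abs]

/-- **The split of `−tr((∇v)²)` in `ℝ³`**: `−tr(Dv ∘ Dv) = ½‖curl v‖² − ¼|Dv + Dvᵀ|²_F = ½|ω|² − |S|²_F` with
`S = ½(Dv + Dvᵀ)` (pure linear algebra; no differentiability needed — both sides use the same `fderiv`). -/
theorem neg_traceCLM_fderiv_comp_self_eq (v : EuclideanSpace ℝ (Fin 3) → EuclideanSpace ℝ (Fin 3))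
    (x : EuclideanSpace ℝ (Fin 3)) :
    -traceCLM ((fderiv ℝ v x).comp (fderiv ℝ v x)) =
      ‖curl v x‖ ^ 2 / 2 - frobeniusNormSq (fderiv ℝ v x + ContinuousLinearMap.adjoint (fderiv ℝ v x)) / 4 := by
  rw [traceCLM_comp_self_eq_sum, frobeniusNormSq_add_adjoint_eq_sum, norm_curl_sq_eq_coord]
  simp only [Fin.sum_univ_three]
  ring

/-- **Pressure Poisson equation, split form in `ℝ³`** (plate «PoissonTrace»): for a classical unforced
Navier–Stokes solution on `[0,T) × ℝ³`, at every interior time `t ∈ (0,T)` and every `x`,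
`Δp(t,x) = ½‖ω(t,x)‖² − ¼|∇u(t,x) + ∇u(t,x)ᵀ|²_F` (= `½|ω|² − |S|²_F`, `S` the strain-rate tensor). -/
theorem laplacian_pressure_eq_half_vorticity_sq_sub {ν T : ℝ}
    {u : ℝ → EuclideanSpace ℝ (Fin 3) → EuclideanSpace ℝ (Fin 3)} {p : ℝ → EuclideanSpace ℝ (Fin 3) → ℝ}
    (hsol : IsClassicalNSSolutionOn (Ico 0 T) ν 0 u p) {t : ℝ} (ht : t ∈ Ioo 0 T) (x : EuclideanSpace ℝ (Fin 3)) :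
    Δ (p t) x = ‖curl (u t) x‖ ^ 2 / 2 -
      frobeniusNormSq (fderiv ℝ (u t) x + ContinuousLinearMap.adjoint (fderiv ℝ (u t) x)) / 4 := by
  rw [laplacian_pressure_eq_neg_traceCLM hsol ht x, neg_traceCLM_fderiv_comp_self_eq]

end Summit.NavierStokesRegularity.NavierStokesRegularity.Theorems.ArgmaxDoors

end
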